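import Summits.BirchSwinnertonDyer.BirchSwinnertonDyer.Theorems.ThetaPartnerAtTwoSignedMainConjectureCMTwoRankZeroLowerOffTwoLayerSide
import Summits.BirchSwinnertonDyer.BirchSwinnertonDyer.Theorems.ThetaPartnerAtTwoSignedKatoUpToAtTwoLayerPairingCompat
import Literature.NumberTheory.EllipticCurves.Kato2004.IwasawaCohomologyExistsProofs
import HarnessLib

/-!
# Route `ThetaPartnerAtTwo` (TP2), crux K2R0P♭ `SignedMainConjectureCMTwoRankZeroOfPubOfFlat` (stmt-BirchSwinnertonDyer-26471; derived
# node K2r0P stmt-BirchSwinnertonDyer-24945), line `rankzero` v16, stub (LDℓ)_A: **(LDℓ)_A from ONE published-input statement (CORE♭-lower)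
# on the tree's OWN objects** — the twin of the K3 lineage's v10 `stub_katoZetaErlTwo` (CORE), for THE `T₂A`-adic local Tate pairing

HONEST FRAMING (cell `pub/bsd-wall`, W-ALL row 1; width seat `bsd-wall-tp2-p2-w2` g3, `--supports` only). ONE THEOREM, an implication
(no definition, no named fact, no instance, no `sorry`); route-independent (no `Theses`/`Cruxes` import); closes no item; the hypothesis
(CORE♭-lower) carries ALL the research / published content; BSD is NOT proved by any of this.

## What is proved

`offTwoLower_of_coreLower` — (LDℓ)_A ⟸ (CORE♭-lower): for every CM class member `A` off the unit zone, cyclotomic datum, newform, `ϖ`, Pollack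
pair, fine dual datum `Y`, height-one `𝔭' ∌ 2`, place `v ∋ 2`, and for EVERY pinned `𝐇¹`-datum `I` and EVERY `ℤ₂`-linear layer pairing family
`pair n : H¹(ℚ_n, T₂A) → Hom(E(ℚ_{2,n}·ℚ_v), ℤ₂)` with (P1) projection formula, (P2) Galois invariance for every `g ∈ Γ_v` and (P3) the RESIDUE
CLAUSE for THE Weil pairings `LayerPairing.weilTowerPk` («`pair` IS the `T₂A`-adic local Tate pairing» — the binders of K3's CORE VERBATIM),
there are a local generator `g`, a plus Honda system `d` ((L)(TR)(GEN)(GEN₀)), a class `s ∈ 𝐇¹` and `m` with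
* (PT♭)_layer — the deep Poitou–Tate half at the local term of Kobayashi's (7.17)/Thm. 7.3 (ii), read on THE pairing: every functional `z` on
  `E(ℚ_{2,∞}·ℚ_v)` whose Kummer values on the witnesses of the `⁺`-Selmer classes vanish has `2^m z(Q) = pair_n(proj_n x)(Q)` on `E⁺(ℚ_n·ℚ_v)`
  for some `x ∈ 𝐇¹`;
* (ERL♭ ⊇) «`L♭ ∣ Col♭(col₀ s)` at `𝔭'`» for every glue `col₀` of `pair` along `I` (Kato Thm. 12.5 / 16.6, for the CM form (15.12.2) + Prop. 15.9;
  the ⊆ half is K3's CORE);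
* (g)^ι «`ℓ_{𝔭'}(𝐇¹/Λs) ≤ ℓ_{ι𝔭'}(X₀)`» (equality half of Kato's IMC 12.10 for `f_A` off `(2)`: JLK 2011 Thm. 5.2 + Kato Lemma 15.13 / (15.16.1)).
Inside: `I` from `Kato2004.nonempty_iwasawaH1Data_holds`, `pair` with (P1)(P2)(P3) from `SignedKatoOffTwo.LayerPairing.exists_linear_layerPairing`
(the (D-layer) THEOREM of tp2-p2x-w3), then `offTwoLower_of_layerSideLowerPackageTwo` (glue, points package, (c), (e), ι-twisted lower road).
So the CM lower port = ONE published-input statement; every object in it is a tree object; no kernel stub remains on this side.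

References: [Kobayashi2003] Thm. 6.2–6.3 (p. 11), (7.17)–(7.21), Thm. 7.3 (pp. 12–13); [Kato2004Asterisque] Conj. 12.10 (p. 224), Thm. 12.5
(p. 222), Prop. 15.9, (15.12.2), Lemma 15.13, (15.16.1) (pp. 258–265), Thm. 16.6, §17.13 (p. 280); [JohnsonLeungKings2011] Thm. 5.2;
[PollackRubin2004] Thm. 7.3; [PerrinRiou1994Invent] §3.6.1.
-/

set_option autoImplicit false
-- the Theorems namespace of this sub repeats the summit name by design (D-0017 nested layout)
set_option linter.dupNamespace false

noncomputable section

open scoped Classical NumberField MatrixGroups ModularForm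

open NumberField IsDedekindDomain CongruenceSubgroup

namespace Summit.BirchSwinnertonDyer.BirchSwinnertonDyer.Theorems

namespace SignedLowerOffTwo

open Literature.NumberTheory.EllipticCurves Literature.NumberTheory.GaloisRepresentations
  WeierstrassCurve ZpExtension Literature.NumberTheory.EllipticCurves.Kobayashi2003
  Literature.NumberTheory.EllipticCurves.Module Literature.NumberTheory.EllipticCurves.Kato2004
  Literature.NumberTheory.EllipticCurves.Kato2004.EulerSystemValues
  Literature.NumberTheory.EllipticCurves.GreenbergSelmer Literature.NumberTheory.EllipticCurves.Sprung2012
  Literature.NumberTheory.EllipticCurves.ModularForms Literature.NumberTheory.EllipticCurves.Rank1Residual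
  Summit.BirchSwinnertonDyer.Rank1Residual.Supersingular SignedKatoOffTwo

/-- **(LDℓ)_A from (CORE♭-lower), the ONE published-input statement of the CM lower port on the tree's own objects** (see the module
docstring): for every `I` and every layer pairing `pair` with (P1), (P2), (P3)[`weilTowerPk`], ∃ `g, d` (Honda), `s`, `m` with (PT♭)_layer,
(ERL♭ ⊇), (g)^ι — THEN (LDℓ)_A. [cite: Kobayashi2003, (7.17)–(7.21), Thm. 7.3 (pp. 12–13)] [cite: Kato2004Asterisque, Conj. 12.10 (p. 224),
Thm. 12.5 (p. 222), Lemma 15.13 and (15.16.1) (pp. 264–265), §17.13 (p. 280)] [cite: JohnsonLeungKings2011, Thm. 5.2] -/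
theorem offTwoLower_of_coreLower
    (hcore : ∀ (v : HeightOneSpectrum (𝓞 ℚ)), ((2 : ℕ) : 𝓞 ℚ) ∈ v.asIdeal →
      ∀ (A : WeierstrassCurve ℚ) [A.IsElliptic] [A.IsGloballyMinimal],
        A.HasCM → A.analyticRank = 0 → GoodSS A 2 → A.frobeniusTrace 2 = 0 →
        2 ∣ A.shaOrder * A.tamagawaProduct →
        ∀ (κ : ZpExtension ℚ 2) (γ : Field.absoluteGaloisGroup ℚ),
          κ.IsCyclotomic → κ.IsTopGenerator γ → IsCyclotomicVariable 2 γ →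
        ∀ [NeZero (A.conductorNorm ℤ)] (f : CuspForm (Gamma0 (A.conductorNorm ℤ)) 2),
          IsNewformOf A f → ∀ (ϖ : ℚ), (ϖ : ℝ) * A.realPeriodRat = plusPeriod f →
        ∀ (Lplus Lminus : IwasawaAlgebra 2), IsPollackPair f 2 Lplus Lminus →
        ∀ [ContinuousSMul ℤ_[2] (A.tateModule 2)] (Y : A.FineSelmerDualData κ γ),
        ∀ 𝔭' : PrimeSpectrum (IwasawaAlgebra 2), 𝔭'.asIdeal.height = 1 →
          PowerSeries.C (2 : ℤ_[2]) ∉ 𝔭'.asIdeal →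
        ∀ (I : Kato2004.IwasawaH1Data A 2 κ γ)
          (pair : ∀ n : ℕ, H1 (tateRep A 2) (κ.layerSubgroup n) →ₗ[ℤ_[2]]
            (localLayerPointsOfEmb κ (closureEmb (K := ℚ) (v.adicCompletion ℚ)) A n →+ ℤ_[2])),
          -- (P1) projection formula
          (∀ (n : ℕ) (x : H1 (tateRep A 2) (κ.layerSubgroup (n + 1))) (Q : localPoints A (v.adicCompletion ℚ))
            (hQ : Q ∈ localLayerPointsOfEmb κ (closureEmb (K := ℚ) (v.adicCompletion ℚ)) A n),
            pair n (layerCores (tateRep A 2) κ n x) ⟨Q, hQ⟩ =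
              pair (n + 1) x ⟨Q, localLayerPointsOfEmb_mono κ (closureEmb (K := ℚ) (v.adicCompletion ℚ)) A (Nat.le_succ n) hQ⟩) →
          -- (P2) Galois invariance, for EVERY `g ∈ Γ_v`
          (∀ (n : ℕ) (g : Field.absoluteGaloisGroup (v.adicCompletion ℚ)) (y : H1 (tateRep A 2) (κ.layerSubgroup n))
            (Q : localPoints A (v.adicCompletion ℚ))
            (hQ : Q ∈ localLayerPointsOfEmb κ (closureEmb (K := ℚ) (v.adicCompletion ℚ)) A n),
            pair n (conjMap (tateRep A 2).toTopRep (κ.layerSubgroup n) (resGalOfEmb (closureEmb (K := ℚ) (v.adicCompletion ℚ)) g) 1 y)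
              ⟨g • Q, smul_mem_localLayerPointsOfEmb κ (closureEmb (K := ℚ) (v.adicCompletion ℚ)) A n g hQ⟩ = pair n y ⟨Q, hQ⟩) →
          -- (P3) residue clause: `pair` IS the `T₂A`-adic local Tate pairing (THE Weil pairings of the tree)
          (∀ (n k : ℕ) (x : H1 (tateRep A 2) (κ.layerSubgroup n))
            (Q : localLayerPointsOfEmb κ (closureEmb (K := ℚ) (v.adicCompletion ℚ)) A n),
            PadicInt.toZModPow k (pair n x Q) =
              LayerPairing.layerPairingPk A κ v (LayerPairing.weilTowerPk A) (LayerPairing.weilTowerPk_pow A)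
                (LayerPairing.weilTowerPk_add_left A) (LayerPairing.weilTowerPk_add_right A) (LayerPairing.weilTowerPk_smul A)
                n k x Q) →
        ∃ (g : Field.absoluteGaloisGroup (v.adicCompletion ℚ))
          (_ : κ.IsTopGenerator (resGalOfEmb (closureEmb (K := ℚ) (v.adicCompletion ℚ)) g))
          (d : ℕ → localPoints A (v.adicCompletion ℚ)) (s : I.H) (m : ℕ),
          (∀ n, d n ∈ localLayerPointsOfEmb κ (closureEmb (K := ℚ) (v.adicCompletion ℚ)) A n) ∧
          (∀ n, localTraceOfEmb κ (closureEmb (K := ℚ) (v.adicCompletion ℚ)) A (n + 1) (n + 2) (d (n + 2)) = -d n) ∧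
          (∀ n : ℕ, 1 ≤ n → ∀ P ∈ localLayerPointsOfEmb κ (closureEmb (K := ℚ) (v.adicCompletion ℚ)) A n,
            ∃ B ∈ AddSubgroup.closure (Set.range fun σ : Field.absoluteGaloisGroup (v.adicCompletion ℚ) ↦ σ • d n),
              ∃ P' ∈ localLayerPointsOfEmb κ (closureEmb (K := ℚ) (v.adicCompletion ℚ)) A (n - 1),
              ∃ R ∈ localLayerPointsOfEmb κ (closureEmb (K := ℚ) (v.adicCompletion ℚ)) A n, P = B + P' + 2 • R) ∧
          (∀ P ∈ localLayerPointsOfEmb κ (closureEmb (K := ℚ) (v.adicCompletion ℚ)) A 0,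
            ∃ a : ℤ, ∃ R ∈ localLayerPointsOfEmb κ (closureEmb (K := ℚ) (v.adicCompletion ℚ)) A 0, P = a • d 0 + 2 • R) ∧
          -- (PT♭)_layer: the deep Poitou–Tate half, read on THE pairing
          (∀ z : localTowerPointsOfEmb κ (closureEmb (K := ℚ) (v.adicCompletion ℚ)) A →+ ℤ_[2],
            (∀ (t : A.subgroupH1 2 κ.kerSubgroup), t ∈ signedSelmerInfty A κ 1 →
              ∀ (φ : contOneCocycles (discreteTopRep κ.kerSubgroup (A.geomPrimaryTorsion 2)))
                (Q : localPoints A (v.adicCompletion ℚ)) (k : ℕ), oneCocycleClass _ φ = t →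
              ∀ hQ : 2 ^ k • Q ∈ (⨆ n, signedLocalPoints κ (v.adicCompletion ℚ) A 1 n),
              (∀ τ : localSubgroupOfEmb κ.kerSubgroup (closureEmb (K := ℚ) (v.adicCompletion ℚ)),
                pointsMapOfEmb A (closureEmb (K := ℚ) (v.adicCompletion ℚ))
                    ((φ.1 (resGalSubgroupOfEmb κ.kerSubgroup _ τ) : A.geomPrimaryTorsion 2) : A.geomPoints) =
                  (τ : Field.absoluteGaloisGroup (v.adicCompletion ℚ)) • Q - Q) →
              (PadicInt.toZModPow k
                  (z ⟨2 ^ k • Q, SignedKatoOffTwo.KummerPoint.iSup_signedLocalPoints_le_localTowerPointsOfEmb A 2 κ 1 v hQ⟩)).val •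
                ((((2 : ℚ) ^ k)⁻¹ : ℚ) : AddCircle (1 : ℚ)) = 0) →
            ∃ x : I.H, ∀ (n : ℕ) (Q : localPoints A (v.adicCompletion ℚ))
              (hQ : Q ∈ signedLocalPointsOfEmb κ (closureEmb (K := ℚ) (v.adicCompletion ℚ)) A 1 n),
              (2 : ℤ_[2]) ^ m *
                  z ⟨Q, localLayerPointsOfEmb_le_localTowerPointsOfEmb κ _ A n (signedLocalPointsOfEmb_le κ _ A 1 n hQ)⟩ =
                pair n (I.proj n x) ⟨Q, signedLocalPointsOfEmb_le κ _ A 1 n hQ⟩) ∧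
          -- (ERL♭ ⊇) for every glue of `pair` along `I`
          (∀ col₀ : I.H →+ (localTowerPointsOfEmb κ (closureEmb (K := ℚ) (v.adicCompletion ℚ)) A →+ ℤ_[2]),
            (∀ (n : ℕ) (x : I.H) (Q : localPoints A (v.adicCompletion ℚ))
              (hQ : Q ∈ localLayerPointsOfEmb κ (closureEmb (K := ℚ) (v.adicCompletion ℚ)) A n),
              col₀ x ⟨Q, localLayerPointsOfEmb_le_localTowerPointsOfEmb κ (closureEmb (K := ℚ) (v.adicCompletion ℚ)) A n hQ⟩ =
                pair n (I.proj n x) ⟨Q, hQ⟩) →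
            ∀ Ls Lf : IwasawaAlgebra 2, IsColemanPair κ (closureEmb (K := ℚ) (v.adicCompletion ℚ)) A 0 g d (col₀ s) Ls Lf →
              lengthAt (IwasawaAlgebra 2) (IwasawaAlgebra 2 ⧸ Ideal.span {kobayashiL 1 Lplus Lminus}) 𝔭' ≤
                lengthAt (IwasawaAlgebra 2) (IwasawaAlgebra 2 ⧸ Ideal.span {Lf}) 𝔭') ∧
          -- (g)^ι the CM `𝐇¹`-side comparison, print-exact mixed-prime form
          lengthAt (IwasawaAlgebra 2) (I.H ⧸ Submodule.span (IwasawaAlgebra 2) {s}) 𝔭' ≤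
            lengthAt (IwasawaAlgebra 2) Y.X (PrimeSpectrum.comap (IwasawaAlgebra.invol 2).toRingHom 𝔭')) :
    ∀ (A : WeierstrassCurve ℚ) [A.IsElliptic] [A.IsGloballyMinimal],
      A.HasCM → A.analyticRank = 0 → GoodSS A 2 → A.frobeniusTrace 2 = 0 →
      2 ∣ A.shaOrder * A.tamagawaProduct →
      ∀ (κ : ZpExtension ℚ 2) (γ : Field.absoluteGaloisGroup ℚ),
        κ.IsCyclotomic → κ.IsTopGenerator γ → IsCyclotomicVariable 2 γ →
      ∀ [NeZero (A.conductorNorm ℤ)] (f : CuspForm (Gamma0 (A.conductorNorm ℤ)) 2),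
        IsNewformOf A f → ∀ (ϖ : ℚ), (ϖ : ℝ) * A.realPeriodRat = plusPeriod f →
      ∀ (Lplus Lminus : IwasawaAlgebra 2), IsPollackPair f 2 Lplus Lminus →
      ∀ (D : SignedSelmerDualData A κ γ 1), Module.IsTorsion (IwasawaAlgebra 2) D.X →
        ∀ 𝔭 : PrimeSpectrum (IwasawaAlgebra 2), 𝔭.asIdeal.height = 1 →
          PowerSeries.C (2 : ℤ_[2]) ∉ 𝔭.asIdeal →
          lengthAt (IwasawaAlgebra 2) (IwasawaAlgebra 2 ⧸ Ideal.span {kobayashiL 1 Lplus Lminus}) 𝔭 ≤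
            lengthAt (IwasawaAlgebra 2) D.X 𝔭 := by
  refine offTwoLower_of_layerSideLowerPackageTwo
    fun v hv A _ _ hcm hr hss ha hz κ γ hκ hγ hcv _ f hf ϖ hϖ Lplus Lminus hPP _ Y 𝔭 h𝔭 hp𝔭 ↦ ?_
  have hv2 : ((2 : ℕ) : 𝓞 ℚ) ∈ v.asIdeal := hv
  -- a pinned `𝐇¹`-datum and THE layer pairings with (P1)(P2)(P3)
  obtain ⟨I⟩ := Kato2004.nonempty_iwasawaH1Data_holds A 2 κ γ hκ hγ
  obtain ⟨pair, hP3, hP1, hP2⟩ := LayerPairing.exists_linear_layerPairing A κ v hκ hv2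
  obtain ⟨g, hg, d, s, m, hL, hTR, hGEN, hGEN0, hPT, hERL, hIMC⟩ :=
    hcore v hv A hcm hr hss ha hz κ γ hκ hγ hcv f hf ϖ hϖ Lplus Lminus hPP Y 𝔭 h𝔭 hp𝔭 I pair hP1 hP2 hP3
  exact ⟨g, hg, d, I, pair, s, m, hL, hTR, hGEN, hGEN0, hP1, fun n y Q hQ ↦ hP2 n g y Q hQ, hPT, hERL, hIMC⟩

end SignedLowerOffTwo

end Summit.BirchSwinnertonDyer.BirchSwinnertonDyer.Theorems

end
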